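import Summits.AnomalousDissipation.AnomalousDissipation.Theorems.SawtoothPulseCascadeK1LocalisedCascadeChirpSidebandEnergy

/-!
# K1loc, line `Spectral` / thin start — helper: SUP NORM OF THE CHIRP CUT-OFF FROM ITS COEFFICIENTS (S-D, «CutoffSup»)

Helper file of the prover lane on the crux `K1LocalisedCascade` (stmt-AnomalousDissipation-19491), route
`SawtoothPulseCascade` (S-D fibre ledger, early phases of the K1loc′ chain where `δ` is small).  The mid-band cut-off
`g^mid_n = ψ_n ⋆ g_n` of the phase-`j` chirp `g_n = twist(γU_j) n` onto a finite frequency set `S` (with a GAP below the main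
frequency `±nG`) is uniformly small, directly from the coefficients of the chirp — no kernel `L¹` norm, no corner envelope:
* §1 `circleCutoff_eq_sum` / `norm_circleCutoff_le_sum`: `(ψ⋆g)(y) = Σ_{l∈S} ψ(l)ĝ(l)e_l(y)`, so `|(ψ⋆g)(y)| ≤ Σ_{l∈S}|ψ(l)||ĝ(l)|`;
* §2 `sum_norm_fourierCoeff_nTooth_le`: for the `N`-tooth exact chirp `g_N = h∘(N•·)` (one-tooth strain `λ′`) and a finite `S`
  whose multiples `q` of `N` satisfy `D′ ≤ |q/N ± λ′|` (`D′ ≥ 1`): `Σ_{q∈S}|ĝ_N(q)| ≤ #{q ∈ S : N ∣ q}·2/(πD′)`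
  (non-multiples vanish, `…SidebandEnergy`; each multiple is a one-tooth sideband coefficient, `…ExactChirp`);
* §3 `norm_fourierCoeff_le_of_norm_le`, `sum_norm_fourierCoeff_le_of_near`: rounding, `Σ_S|ĝ(q)| ≤ Σ_S|ĝ_N(q)| + #S·ε` if
  `|g − g_N| ≤ ε`;
* §4 **`norm_circleCutoff_twist_cascade_le`**: for `ψ_c` supported in `S` with `|ψ_c| ≤ 1`, `N_jλ′ = nG`, notch
  `N_jD′ ≤ |q ± nG|` on the multiples `q ∈ S` of `N_j`:
  `sup_y |(ψ_c ⋆ twist(γU_j) n)(y)| ≤ #{q∈S : N_j ∣ q}·2/(πD′) + #S·|n|G(2e^{1/2}−1)δ_j/N_j`.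
This is the constant majorant `ρ` of `…FibreWindow.sum_window_sq_norm_comp_shearMap_le` / `…HalfStepSup`: junk energy
`≤ ρ²·(tracked L² energy)`, `ρ ≈ (2/π)·(2p/D)` for a plateau `|m| ≤ p` at distance `D` from `±nG`.
No definitions; nothing about the crux. [cite: Grafakos2014, Prop. 3.1.2 (5) and Prop. 3.2.7 (3)] [problem: turb]
-/

-- `Summit.<Summit>.<Problem>`: single-conjunct summit, the duplicate namespace segment is deliberate.
set_option linter.dupNamespace false

noncomputable section

namespace Summit.AnomalousDissipation.AnomalousDissipation.Theorems.SawtoothPulseCascade.K1Start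

open MeasureTheory Set Filter Topology UnitAddTorus Function Complex AddCircle
open scoped Real
open Literature.Analysis Literature.Analysis.FunctionSpaces Literature.Analysis.FunctionSpaces.Torus Literature.Analysis.FluidPDE
open Literature.Analysis.FluidPDE.ShearStage
open Literature.Analysis.FluidPDE.SawtoothCascade Literature.Analysis.FluidPDE.SawtoothCascade.CascadeParams
open Summit.AnomalousDissipation.AnomalousDissipation.Theorems.SawtoothPulseCascade.K1Window

/-! ## §1 The cut-off as a finite Fourier sum; its sup norm -/

/-- **The cut-off is a finite Fourier sum**: for continuous `g` and a finite `S`,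
`∫ (Σ_{l∈S} ψ(l)e_{−l}(s)) g(y + s) ds = Σ_{l∈S} ψ(l)·e_l(y)·ĝ(l)`. [cite: Grafakos2014, Prop. 3.1.2 (5)] -/
theorem circleCutoff_eq_sum {g : UnitAddCircle → ℂ} (hg : Continuous g) (ψ : ℤ → ℂ) (S : Finset ℤ) (y : UnitAddCircle) :
    ∫ s : UnitAddCircle, (∑ l ∈ S, ψ l * fourier (-l) s) * g (y + s) =
      ∑ l ∈ S, ψ l * (fourier l y * fourierCoeff g l) := by
  have hI : ∀ l : ℤ, Integrable fun s : UnitAddCircle => ψ l * ((fourier (-l) s : ℂ) * g (y + s)) := fun l =>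
    (continuous_const.mul ((fourier (-l)).continuous.mul (hg.comp (continuous_const.add continuous_id))))
      |>.integrable_of_hasCompactSupport (HasCompactSupport.of_compactSpace _)
  have h1 : (fun s : UnitAddCircle => (∑ l ∈ S, ψ l * fourier (-l) s) * g (y + s)) =
      fun s => ∑ l ∈ S, ψ l * ((fourier (-l) s : ℂ) * g (y + s)) := by
    funext s; rw [Finset.sum_mul]; refine Finset.sum_congr rfl fun l _ => ?_; ring
  rw [h1, integral_finsetSum _ fun l _ => hI l]
  refine Finset.sum_congr rfl fun l _ => ?_
  rw [integral_const_mul]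
  congr 1
  have h2 : (fun s : UnitAddCircle => (fourier (-l) s : ℂ) * g (y + s)) = fun s => (fourier (-l) s : ℂ) * g (s + y) := by
    funext s; rw [add_comm]
  rw [h2, integral_fourier_neg_mul_translate g l y]

/-- **Sup norm of the cut-off from the coefficients**: `|∫ (Σ_{l∈S} ψ(l)e_{−l}(s)) g(y + s) ds| ≤ Σ_{l∈S} |ψ(l)|·|ĝ(l)|` for
every `y`. [cite: Grafakos2014, Prop. 3.1.2 (5)] -/
theorem norm_circleCutoff_le_sum {g : UnitAddCircle → ℂ} (hg : Continuous g) (ψ : ℤ → ℂ) (S : Finset ℤ) (y : UnitAddCircle) :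
    ‖∫ s : UnitAddCircle, (∑ l ∈ S, ψ l * fourier (-l) s) * g (y + s)‖ ≤ ∑ l ∈ S, ‖ψ l‖ * ‖fourierCoeff g l‖ := by
  rw [circleCutoff_eq_sum hg ψ S y]
  refine (norm_sum_le _ _).trans (Finset.sum_le_sum fun l _ => ?_)
  have h1 : ‖(fourier l y : ℂ)‖ = 1 := Circle.norm_coe _
  rw [norm_mul, norm_mul, h1, one_mul]

/-! ## §2 The `N`-tooth exact chirp: `ℓ¹` of its coefficients on a set with a gap -/

/-- **`ℓ¹` bound for the `N`-tooth exact chirp on a set with a gap**: `g_N = h ∘ (N•·)`, `h(t) = exp(−2πiλ′tri(2πt)/(2π))`,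
`N ≥ 1`; if every multiple `q ∈ S` of `N` satisfies `D′ ≤ |q/N + λ′|` and `D′ ≤ |q/N − λ′|` (`D′ ≥ 1`), then
`Σ_{q∈S} |ĝ_N(q)| ≤ #{q ∈ S : N ∣ q} · 2/(πD′)`. [cite: Grafakos2014, Prop. 3.1.2 (5)] -/
theorem sum_norm_fourierCoeff_nTooth_le {N : ℕ} (hN : 0 < N) {lam' : ℤ} {h : UnitAddCircle → ℂ}
    (hh : ∀ t : ℝ, h (t : UnitAddCircle) = Complex.exp (-(2 * π * I * lam' * ((tri (2 * π * t) / (2 * π) : ℝ) : ℂ))))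
    (hhc : Continuous h) {D' : ℕ} (hD' : 1 ≤ D') (S : Finset ℤ)
    (hS : ∀ q ∈ S, (N : ℤ) ∣ q → (D' : ℤ) ≤ |q / N + lam'| ∧ (D' : ℤ) ≤ |q / N - lam'|) :
    ∑ q ∈ S, ‖fourierCoeff (fun t : UnitAddCircle => h (N • t)) q‖ ≤
      ((S.filter fun q : ℤ => (N : ℤ) ∣ q).card : ℝ) * (2 / (π * D')) := by
  classical
  have hπ : 0 < π := Real.pi_pos
  have hNz : (N : ℤ) ≠ 0 := by exact_mod_cast hN.ne'
  have hD'r : (1 : ℝ) ≤ D' := by exact_mod_cast hD'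
  -- drop the non-multiples
  have hsplit : ∑ q ∈ S, ‖fourierCoeff (fun t : UnitAddCircle => h (N • t)) q‖ =
      ∑ q ∈ S.filter (fun q : ℤ => (N : ℤ) ∣ q), ‖fourierCoeff (fun t : UnitAddCircle => h (N • t)) q‖ := by
    rw [← Finset.sum_filter_add_sum_filter_not S (fun q : ℤ => (N : ℤ) ∣ q)]
    have h0 : ∑ q ∈ S.filter (fun q : ℤ => ¬ (N : ℤ) ∣ q), ‖fourierCoeff (fun t : UnitAddCircle => h (N • t)) q‖ = 0 :=
      Finset.sum_eq_zero fun q hq => by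
        rw [fourierCoeff_comp_nsmul_eq_zero hN hhc (Finset.mem_filter.1 hq).2, norm_zero]
    rw [h0, add_zero]
  rw [hsplit]
  -- each multiple is a one-tooth coefficient in the sideband
  have hterm : ∀ q ∈ S.filter (fun q : ℤ => (N : ℤ) ∣ q),
      ‖fourierCoeff (fun t : UnitAddCircle => h (N • t)) q‖ ≤ 2 / (π * D') := by
    intro q hq
    obtain ⟨hqS, hdvd⟩ := Finset.mem_filter.1 hq
    obtain ⟨q', rfl⟩ := hdvd
    have hq' : ((N : ℤ) * q') / N = q' := Int.mul_ediv_cancel_left q' hNz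
    have hnotch := hS _ hqS ⟨q', rfl⟩
    rw [hq'] at hnotch
    rw [fourierCoeff_comp_nsmul_mul hN hhc q']
    have hne₁ : q' ≠ -lam' := by
      intro h1; rw [h1, neg_add_cancel, abs_zero] at hnotch; have := hnotch.1; omega
    have hne₂ : q' ≠ lam' := by
      intro h1; rw [h1, sub_self, abs_zero] at hnotch; have := hnotch.2; omega
    have hb := norm_fourierCoeff_exactChirp_le hh hhc hne₁ hne₂
    have h1 : (D' : ℝ) ≤ |((lam' + q' : ℤ) : ℝ)| := by
      rw [← Int.cast_abs, show lam' + q' = q' + lam' by ring]; exact_mod_cast hnotch.1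
    have h2 : (D' : ℝ) ≤ |((lam' - q' : ℤ) : ℝ)| := by
      rw [← Int.cast_abs, show |lam' - q'| = |q' - lam'| from abs_sub_comm _ _]; exact_mod_cast hnotch.2
    have hD'pos : (0 : ℝ) < D' := by linarith
    calc ‖fourierCoeff h q'‖ ≤ 1 / (π * |((lam' + q' : ℤ) : ℝ)|) + 1 / (π * |((lam' - q' : ℤ) : ℝ)|) := hb
      _ ≤ 1 / (π * D') + 1 / (π * D') := by
          gcongr
      _ = 2 / (π * D') := by ring
  calc ∑ q ∈ S.filter (fun q : ℤ => (N : ℤ) ∣ q), ‖fourierCoeff (fun t : UnitAddCircle => h (N • t)) q‖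
      ≤ ∑ q ∈ S.filter (fun q : ℤ => (N : ℤ) ∣ q), 2 / (π * D') := Finset.sum_le_sum hterm
    _ = ((S.filter fun q : ℤ => (N : ℤ) ∣ q).card : ℝ) * (2 / (π * D')) := by
        rw [Finset.sum_const, nsmul_eq_mul]

/-! ## §3 Rounding in `ℓ¹` over a finite set -/

/-- A Fourier coefficient is at most the sup norm: `|𝓕F(q)| ≤ B` if `|F| ≤ B`. [cite: Grafakos2014, Prop. 3.2.7 (3)] -/
theorem norm_fourierCoeff_le_of_norm_le {F : UnitAddCircle → ℂ} {B : ℝ} (hB : ∀ x, ‖F x‖ ≤ B) (q : ℤ) :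
    ‖fourierCoeff F q‖ ≤ B := by
  rw [fourierCoeff]
  have h := norm_integral_le_of_norm_le_const (μ := haarAddCircle)
    (f := fun t : UnitAddCircle => (fourier (-q) t : ℂ) • F t) (C := B)
    (Eventually.of_forall fun t => by
      have h1 : ‖(fourier (-q) t : ℂ)‖ = 1 := Circle.norm_coe _
      rw [norm_smul, h1, one_mul]; exact hB t)
  simpa using h

/-- **Rounding in `ℓ¹`**: if `g, g₀` are continuous with `|g − g₀| ≤ ε` pointwise, then for every finite `S`
`Σ_{q∈S}|ĝ(q)| ≤ Σ_{q∈S}|ĝ₀(q)| + #S·ε`. [cite: Grafakos2014, Prop. 3.2.7 (3)] -/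
theorem sum_norm_fourierCoeff_le_of_near {g g₀ : UnitAddCircle → ℂ} (hg : Continuous g) (hg₀ : Continuous g₀)
    {ε : ℝ} (hε : ∀ x, ‖g x - g₀ x‖ ≤ ε) (S : Finset ℤ) :
    ∑ q ∈ S, ‖fourierCoeff g q‖ ≤ ∑ q ∈ S, ‖fourierCoeff g₀ q‖ + (S.card : ℝ) * ε := by
  have hint : ∀ (f : UnitAddCircle → ℂ), Continuous f → ∀ q : ℤ,
      Integrable (fun x : UnitAddCircle => (fourier (-q) x : ℂ) • f x) haarAddCircle := fun f hf q =>
    ((fourier (-q)).continuous.smul hf).integrable_of_hasCompactSupport (HasCompactSupport.of_compactSpace _)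
  have hsub : ∀ q, fourierCoeff g q - fourierCoeff g₀ q = fourierCoeff (fun x => g x - g₀ x) q := by
    intro q
    simp only [fourierCoeff, smul_sub]
    rw [integral_sub (hint g hg q) (hint g₀ hg₀ q)]
  have hq : ∀ q ∈ S, ‖fourierCoeff g q‖ ≤ ‖fourierCoeff g₀ q‖ + ε := by
    intro q _
    have h1 : ‖fourierCoeff (fun x => g x - g₀ x) q‖ ≤ ε := norm_fourierCoeff_le_of_norm_le hε q
    calc ‖fourierCoeff g q‖ = ‖fourierCoeff g₀ q + (fourierCoeff g q - fourierCoeff g₀ q)‖ := by ring_nf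
      _ ≤ ‖fourierCoeff g₀ q‖ + ‖fourierCoeff g q - fourierCoeff g₀ q‖ := norm_add_le _ _
      _ ≤ ‖fourierCoeff g₀ q‖ + ε := by rw [hsub]; linarith
  calc ∑ q ∈ S, ‖fourierCoeff g q‖ ≤ ∑ q ∈ S, (‖fourierCoeff g₀ q‖ + ε) := Finset.sum_le_sum hq
    _ = ∑ q ∈ S, ‖fourierCoeff g₀ q‖ + (S.card : ℝ) * ε := by
        rw [Finset.sum_add_distrib, Finset.sum_const, nsmul_eq_mul]

/-! ## §4 The cascade instance: sup norm of the cut-off of the phase-`j` chirp -/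

/-- **Sup norm of the cut-off of the phase-`j` chirp.**  Cascade parameters with `δ₀ > 0`, `d > 0`, `N_j ≥ 1`, `γ = G ∈ ℕ`; a
fibre `n` and `λ′` with `N_j·λ′ = n·G`; a finite `S` and a multiplier `ψ_c` with `‖ψ_c‖ ≤ 1` on `S`; the notch condition
`N_j·D′ ≤ |q + nG|`, `N_j·D′ ≤ |q − nG|` for the multiples `q ∈ S` of `N_j` (`D′ ≥ 1`).  Then for every `y`,
`|(ψ_c ⋆ twist(γU_j) n)(y)| ≤ #{q∈S : N_j ∣ q}·2/(πD′) + #S·|n|G(2e^{1/2}−1)δ_j/N_j`.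
[cite: Grafakos2014, Prop. 3.1.2 (5) and Prop. 3.2.7 (3)] -/
theorem norm_circleCutoff_twist_cascade_le (P : CascadeParams) (hδ₀ : 0 < P.δ₀) (hd : 0 < P.d) {j : ℕ} (hN : 0 < P.N j)
    {G : ℕ} (hG : P.γ = G) (n lam' : ℤ) (hlam : (P.N j : ℤ) * lam' = n * G)
    {ψc : ℤ → ℂ} (S : Finset ℤ) (hψc1 : ∀ m ∈ S, ‖ψc m‖ ≤ 1) {D' : ℕ} (hD' : 1 ≤ D')
    (hS : ∀ q ∈ S, (P.N j : ℤ) ∣ q → (P.N j : ℤ) * D' ≤ |q + n * G| ∧ (P.N j : ℤ) * D' ≤ |q - n * G|)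
    (y : UnitAddCircle) :
    ‖∫ s : UnitAddCircle, (∑ l ∈ S, ψc l * fourier (-l) s) *
        twist (amp ⟨P.U j, P.U_periodic j, P.contDiff_U (P.δ_pos hδ₀ hd j)⟩ P.γ) n (y + s)‖ ≤
      ((S.filter fun q : ℤ => (P.N j : ℤ) ∣ q).card : ℝ) * (2 / (π * D')) +
        (S.card : ℝ) * (|(n : ℝ)| * G * ((2 * Real.exp (1 / 2) - 1) * P.δ j / P.N j)) := by
  classical
  obtain ⟨h, hhc, hh⟩ := exists_exactChirp lam'
  have hπ : 0 < π := Real.pi_pos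
  have hNr : (0 : ℝ) < P.N j := by exact_mod_cast hN
  set Ψ : ShearProfile := amp ⟨P.U j, P.U_periodic j, P.contDiff_U (P.δ_pos hδ₀ hd j)⟩ P.γ with hΨ
  -- §1: the cut-off is at most the `ℓ¹` norm of the coefficients on `S`
  have h1 := norm_circleCutoff_le_sum (continuous_twist Ψ n) ψc S y
  have h2 : ∑ l ∈ S, ‖ψc l‖ * ‖fourierCoeff (twist Ψ n) l‖ ≤ ∑ l ∈ S, ‖fourierCoeff (twist Ψ n) l‖ :=
    Finset.sum_le_sum fun l hl => by
      have := hψc1 l hl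
      nlinarith [norm_nonneg (fourierCoeff (twist Ψ n) l), norm_nonneg (ψc l)]
  -- §3: rounding, pointwise `‖twist Ψ n − g_N‖ ≤ 2πη`
  have hgc : Continuous fun t : UnitAddCircle => h (P.N j • t) := hhc.comp (continuous_nsmul _)
  have hη := abs_phase_sub_nTooth_le P hδ₀ hd hN hG n lam' hlam
  have hnear : ∀ x : UnitAddCircle, ‖twist Ψ n x - h (P.N j • x)‖ ≤
      2 * π * (|(n : ℝ)| * G * ((2 * Real.exp (1 / 2) - 1) * P.δ j / (2 * π * P.N j))) := by
    intro x
    obtain ⟨t, rfl⟩ := QuotientAddGroup.mk_surjective x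
    have hx : (QuotientAddGroup.mk t : UnitAddCircle) = ((t : ℝ) : UnitAddCircle) := rfl
    rw [hx, twist_coe, nTooth_coe (P.N j) hh t]
    have h3 := norm_exp_neg_two_pi_I_sub_le (n * Ψ t) (lam' * (tri (2 * π * (P.N j * t)) / (2 * π)))
    have e1 : Complex.exp (-(2 * π * I * ((n * Ψ t : ℝ) : ℂ))) = Complex.exp (-(2 * Real.pi * Complex.I * n * Ψ t)) := by
      congr 1; push_cast; ring
    have e2 : Complex.exp (-(2 * π * I * ((lam' * (tri (2 * π * (P.N j * t)) / (2 * π)) : ℝ) : ℂ))) =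
        Complex.exp (-(2 * π * I * lam' * ((tri (2 * π * (P.N j * t)) / (2 * π) : ℝ) : ℂ))) := by
      congr 1; push_cast; ring
    rw [e1, e2] at h3
    refine h3.trans ?_
    have := hη t
    nlinarith [Real.pi_pos, abs_nonneg (n * Ψ t - lam' * (tri (2 * π * (P.N j * t)) / (2 * π)))]
  have h4 := sum_norm_fourierCoeff_le_of_near (continuous_twist Ψ n) hgc hnear S
  -- §2: the exact `N_j`-tooth chirp on the set with a gap
  have hS' : ∀ q ∈ S, (P.N j : ℤ) ∣ q → (D' : ℤ) ≤ |q / P.N j + lam'| ∧ (D' : ℤ) ≤ |q / P.N j - lam'| := by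
    intro q hq hdq
    refine sideband_div_of_mul hN hdq ?_
    rw [hlam]
    exact hS q hq hdq
  have h5 := sum_norm_fourierCoeff_nTooth_le hN hh hhc hD' S hS'
  have e : 2 * π * (|(n : ℝ)| * G * ((2 * Real.exp (1 / 2) - 1) * P.δ j / (2 * π * P.N j))) =
      |(n : ℝ)| * G * ((2 * Real.exp (1 / 2) - 1) * P.δ j / P.N j) := by
    field_simp
  rw [e] at h4
  linarith [h1, h2, h4, h5]

end Summit.AnomalousDissipation.AnomalousDissipation.Theorems.SawtoothPulseCascade.K1Start
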